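import Mathlib
import Literature.NumberTheory.LFunctions.Zhang2022.Section4Prop22Windows
import Literature.NumberTheory.LFunctions.Zhang2022.Section4Prop22Edge
import HarnessLib

/-!
# Zhang (2022), typed skeleton: Proposition 2.2 (iii) on the inner window from Lemmas 4.2, 4.6, 4.7
# AS PRINTED (DAG node `Z22:Ded22`; GAP row G-d15-1 — what survives without repairing the windows)

Topic `Literature/NumberTheory/LFunctions/Zhang2022` (Landau–Siegel audit tree; verdict-neutral).
Y. Zhang, *Discrete mean estimates and the Landau–Siegel zero*, arXiv:2211.02515v1 (2022)
[Zhang2022LandauSiegel] — **an unrefereed manuscript under adjudication**; `Lemma42`, `Lemma46 c′`,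
`Lemma47 c′`, `Prop22i`, `Prop22iii c′` are the skeleton's CLAIM nodes, stated not asserted. The
manuscript's deduction of Proposition 2.2 (iii) (PDF p. 23, tex L1263–L1264: "It is also proved
that the gap between any distinct zeros of `𝒜(s,ψ)` in `Ω` is `> α(1 − c′α𝓛)`. To complete the
proof of the gap assertion (iii), it now suffices to prove [Lemma 4.7]") does not go through AS
TYPED (GAP row G-d15-1: Lemmas 4.5–4.7 live on `Ω`'s own height-window `𝓛₁ + 2`, so the companion
zeros that Lemma 4.7 attaches to a zero close to the horizontal edges of `Ω` escape every typed
hypothesis — seam (s2); and the printed OPEN punctured disc of Lemma 4.6 (iii) cannot give the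
STRICT lower inequality of (iii) at the same `c′` — seam (s3)). `Section4Prop22Edge` proves the
deduction over REPAIRED statements (window `𝓛₁ + 5/2`). This file localises the failure instead:
from the banked nodes AS PRINTED, (iii) holds for every consecutive pair of zeros of `Ω` whose
lower zero lies in the inner window `|γ − 2πt₀| < 𝓛₁ + 3/2` (its companions `ρ + w`,
`|w| < α(1 + c′α𝓛) < 1/2`, then lie in `Ω`, where Proposition 2.2 (i) puts them on the line):

* `prop22iii_inner_of_printed` — **`Lemma42 → Prop22i → Lemma46 c′ → Lemma47 c′ →
  ∀ c″ > c′, (iii) on the inner window with constant c″`** (all four antecedents are banked nodes,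
  verbatim; `Prop22i` itself follows from Lemmas 4.5/4.6 plus the proof's Case 2 at the seam
  `σ = 1/2 + α²`, `Section4.prop22i_of` of `TypedSection04C`);
* `prop22iii_inner_le_of_printed` — same antecedents (banked nodes verbatim), SAME `c′`, two-sided
  with a non-strict lower side: `α − c′α²𝓛 ≤ γ′ − γ < α + c′α²𝓛`;
* `prop22iii_inner_of_closed_disc` — the same with Lemma 4.6 (iii) in CLOSED-disc form (printed
  window) and the SAME `c′`, strict on both sides.

Since Lemma 2.3 only consumes (iii) at zeros `ρ ∈ 𝔷(ψ)` (window `𝓛₁`, (2.14)) and their neighbours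
within `3α`, the inner-window form is all that the §2 endgame uses (the re-threading, if adopted,
is the skeleton owner's call — this file only proves the implications).

What is NOT asserted: any of Lemmas 4.2, 4.6, 4.7 or Proposition 2.2 (i) (hypotheses), hence not
(iii); nothing about Theorems 1–2 of the source; nothing bearing on the verdict on (8.24).

## References

* Y. Zhang, arXiv:2211.02515v1 (2022), §2 Proposition 2.2 (iii) (PDF p. 7, tex L419–L421,
  restated tex L463), (2.14); §4 p. 23 (tex L1263–L1277). [cite: Zhang2022LandauSiegel, §4 p. 23]
-/

noncomputable section

open Complex Real ComplexConjugate

namespace Literature.NumberTheory.LFunctions.Zhang2022.Skeleton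

/-! ## Proposition 2.2 (iii) on the inner window from the lemmas AS PRINTED (seam (s2) localised) -/

/-- **(iii) for the zeros of the inner window `|γ − 2πt₀| < 𝓛₁ + 3/2`, from Lemma 4.2, Proposition
2.2 (i), Lemma 4.6 (iii) on its PRINTED window with the CLOSED punctured disc, and Lemma 4.7 AS
PRINTED**: for consecutive zeros `ρ = 1/2 + iγ`, `ρ′` of `L(s,ψ)L(s,ψχ)` in `Ω` with
`|γ − 2πt₀| < 𝓛₁ + 3/2`, `|γ′ − γ − α| < c′α²𝓛` (same `c′`). The companions `ρ + w` of Lemma 4.7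
(`|w| < α(1 + c′α𝓛) < 1/2`) then lie in `Ω`, where (i) puts them on the line — so the printed
height-window `𝓛₁ + 2` of Lemmas 4.5–4.7 suffices for all consecutive pairs except those whose
lower zero lies within `1/2` of the horizontal edges of `Ω` (GAP row G-d15-1, seam (s2), is exactly
that edge strip). [cite: Zhang2022LandauSiegel, §4 p. 23, tex L1263–L1264] -/
theorem prop22iii_inner_of_closed_disc (c' : ℝ) (h42 : Lemma42) (hI : Prop22i)
    (h46 : ForAllLarge fun D _ χ => ∀ x ∈ PsiOne χ, ∀ ρ : ℂ, calA χ x ρ = 0 →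
      1 / 2 ≤ ρ.re → ρ.re < 1 / 2 + alpha D ^ 2 → |ρ.im - 2 * π * t0 D| < ell1 D + 2 →
        ∀ w : ℂ, 0 < ‖w‖ → ‖w‖ ≤ alpha D * (1 - c' * alpha D * ell D) → calA χ x (ρ + w) ≠ 0)
    (h47 : Lemma47 c') :
    ForAllLarge fun D _ χ => ∀ x ∈ PsiOne χ, ∀ s ∈ prodZeroSetOmega χ x,
      ∀ s' ∈ prodZeroSetOmega χ x, |s.im - 2 * π * t0 D| < ell1 D + 3 / 2 → s.im < s'.im →
        (∀ s'' ∈ prodZeroSetOmega χ x, ¬ (s.im < s''.im ∧ s''.im < s'.im)) →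
          |s'.im - s.im - alpha D| < c' * alpha D ^ 2 * ell D := by
  obtain ⟨C₂, h2⟩ := h42
  obtain ⟨D₀, hall⟩ := ((h2.and hI).and h46).and h47
  refine ⟨max D₀ ⌈Real.exp (3 * Real.pi * |c'| + 4 + 2 * max C₂ 1)⌉₊,
    fun D _ χ hD hq hp x hx s hs s' hs' hsin hlt hcons => ?_⟩
  obtain ⟨⟨⟨h42D, hID⟩, h46D⟩, h47D⟩ := hall D χ (le_trans (le_max_left _ _) hD) hq hp
  obtain ⟨hD3, hα, hℓ0, hRR, hR_half, hR_log, hlogpos, h227⟩ :=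
    edge_thresholds (c' := c') (C₂ := C₂) (le_trans (le_max_right _ _) hD)
  have hF0 : ∀ z ∈ Omega1 D, Fpoly χ x z ≠ 0 := by
    intro z hz hF
    have h := h42D x hx z hz
    rw [hF, zero_mul, zero_sub, norm_neg, norm_one] at h
    linarith
  -- (i) in the form consumed by the counting lemmas (window `𝓛₁ + 2` = `Ω`'s)
  have hline : ∀ z : ℂ, 0 < z.re → z.re < 1 → |z.im - 2 * π * t0 D| < ell1 D + 2 →
      LL χ x z = 0 → z.re = 1 / 2 := by
    intro z h0 h1 hw hz
    refine hID x hx z ⟨(mem_Omega_iff' z).mpr ⟨?_, hw⟩, hz⟩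
    rw [abs_lt]
    constructor <;> linarith
  have hsre : s.re = 1 / 2 := hID x hx s hs
  have hs're : s'.re = 1 / 2 := hID x hx s' hs'
  obtain ⟨hsΩ, hsz⟩ := hs
  obtain ⟨hs'Ω, hs'z⟩ := hs'
  obtain ⟨-, hsim⟩ := (mem_Omega_iff' s).mp hsΩ
  obtain ⟨-, hs'im⟩ := (mem_Omega_iff' s').mp hs'Ω
  obtain ⟨hi1, hi2⟩ := abs_lt.mp hsim
  have hz : LL χ x s = 0 := hsz
  have hz' : LL χ x s' = 0 := hs'z
  have hA : calA χ x s = 0 := by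
    simp only [calA, hz, zero_div]
  have hT3 := h47D x hx s hA hsre hsim
  have hdisc := h46D x hx s hA hsre.symm.le (by rw [hsre]; nlinarith) hsim
  have hW₀ : (3 / 2 : ℝ) ≤ 2 := by norm_num
  have hW : (3 / 2 : ℝ) + 1 / 2 ≤ 2 := by norm_num
  have hdlt : s'.im - s.im < alpha D * (1 + c' * alpha D * ell D) :=
    gap_lt_of_three_zeros_win hα hRR hR_half hR_log hF0 hline
      (fun ρ hAρ h1 h2 hw w h0 hlt' => h46D x hx ρ hAρ h1 h2 hw w h0 hlt'.le)
      hT3 hsre hW₀ hW hsin hz hs'im hcons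
  have hdgt : alpha D * (1 - c' * alpha D * ell D) < s'.im - s.im :=
    gap_gt_of_punctured_disc_win hR_half hR_log hF0 hline hdisc hsre hW₀ hW hsin hs're hz' hlt hdlt
  have e1 : alpha D * (1 + c' * alpha D * ell D) = alpha D + c' * alpha D ^ 2 * ell D := by ring
  have e2 : alpha D * (1 - c' * alpha D * ell D) = alpha D - c' * alpha D ^ 2 * ell D := by ring
  rw [abs_lt]
  constructor <;> linarith

/-- **(iii) on the inner window from the banked nodes AS PRINTED — `Lemma42`, `Prop22i`,
`Lemma46 c′` (open punctured disc), `Lemma47 c′` — at every larger parameter `c″ > c′`**: the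
printed §4 material proves `R₋ ≤ γ′ − γ < R₊` (`R± = α ± c′α²𝓛`) for consecutive zeros of `Ω` whose
lower zero satisfies `|γ − 2πt₀| < 𝓛₁ + 3/2`, hence `|γ′ − γ − α| < c″α²𝓛`. This is the exact extent to
which the typed `DedProp22iii c′`/`Ded22 c′` go through without repairing the lemma statements
(what fails as typed: the edge strip of seam (s2) and the strictness of seam (s3), GAP row G-d15-1).
[cite: Zhang2022LandauSiegel, §4 p. 23, tex L1263–L1264] -/
theorem prop22iii_inner_of_printed (c' : ℝ) (h42 : Lemma42) (hI : Prop22i) (h46 : Lemma46 c')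
    (h47 : Lemma47 c') (c'' : ℝ) (hc : c' < c'') :
    ForAllLarge fun D _ χ => ∀ x ∈ PsiOne χ, ∀ s ∈ prodZeroSetOmega χ x,
      ∀ s' ∈ prodZeroSetOmega χ x, |s.im - 2 * π * t0 D| < ell1 D + 3 / 2 → s.im < s'.im →
        (∀ s'' ∈ prodZeroSetOmega χ x, ¬ (s.im < s''.im ∧ s''.im < s'.im)) →
          |s'.im - s.im - alpha D| < c'' * alpha D ^ 2 * ell D := by
  obtain ⟨C₂, h2⟩ := h42
  obtain ⟨D₀, hall⟩ := ((h2.and hI).and h46).and h47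
  refine ⟨max D₀ ⌈Real.exp (3 * Real.pi * |c'| + 4 + 2 * max C₂ 1)⌉₊,
    fun D _ χ hD hq hp x hx s hs s' hs' hsin hlt hcons => ?_⟩
  obtain ⟨⟨⟨h42D, hID⟩, h46D⟩, h47D⟩ := hall D χ (le_trans (le_max_left _ _) hD) hq hp
  obtain ⟨hD3, hα, hℓ0, hRR, hR_half, hR_log, hlogpos, h227⟩ :=
    edge_thresholds (c' := c') (C₂ := C₂) (le_trans (le_max_right _ _) hD)
  have hF0 : ∀ z ∈ Omega1 D, Fpoly χ x z ≠ 0 := by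
    intro z hz hF
    have h := h42D x hx z hz
    rw [hF, zero_mul, zero_sub, norm_neg, norm_one] at h
    linarith
  have hline : ∀ z : ℂ, 0 < z.re → z.re < 1 → |z.im - 2 * π * t0 D| < ell1 D + 2 →
      LL χ x z = 0 → z.re = 1 / 2 := by
    intro z h0 h1 hw hz
    refine hID x hx z ⟨(mem_Omega_iff' z).mpr ⟨?_, hw⟩, hz⟩
    rw [abs_lt]
    constructor <;> linarith
  have hsre : s.re = 1 / 2 := hID x hx s hs
  have hs're : s'.re = 1 / 2 := hID x hx s' hs'
  obtain ⟨hsΩ, hsz⟩ := hs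
  obtain ⟨hs'Ω, hs'z⟩ := hs'
  obtain ⟨-, hsim⟩ := (mem_Omega_iff' s).mp hsΩ
  obtain ⟨-, hs'im⟩ := (mem_Omega_iff' s').mp hs'Ω
  obtain ⟨hi1, hi2⟩ := abs_lt.mp hsim
  have hz : LL χ x s = 0 := hsz
  have hz' : LL χ x s' = 0 := hs'z
  have hA : calA χ x s = 0 := by
    simp only [calA, hz, zero_div]
  have hT3 := h47D x hx s hA hsre hsim
  obtain ⟨-, -, hdisc⟩ := h46D x hx s hA hsre.symm.le (by rw [hsre]; nlinarith) hsim
  have hW₀ : (3 / 2 : ℝ) ≤ 2 := by norm_num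
  have hW : (3 / 2 : ℝ) + 1 / 2 ≤ 2 := by norm_num
  have hdlt : s'.im - s.im < alpha D * (1 + c' * alpha D * ell D) :=
    gap_lt_of_three_zeros_win hα hRR hR_half hR_log hF0 hline
      (fun ρ hAρ h1 h2 hw => (h46D x hx ρ hAρ h1 h2 hw).2.2) hT3 hsre hW₀ hW hsin hz hs'im hcons
  have hdge : alpha D * (1 - c' * alpha D * ell D) ≤ s'.im - s.im :=
    gap_ge_of_open_punctured_disc_win hR_half hR_log hF0 hline hdisc hsre hW₀ hW hsin hs're hz'
      hlt hdlt
  have e1 : alpha D * (1 + c' * alpha D * ell D) = alpha D + c' * alpha D ^ 2 * ell D := by ring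
  have e2 : alpha D * (1 - c' * alpha D * ell D) = alpha D - c' * alpha D ^ 2 * ell D := by ring
  have hpos : 0 < alpha D ^ 2 * ell D := by positivity
  have hcc : c' * alpha D ^ 2 * ell D < c'' * alpha D ^ 2 * ell D := by nlinarith
  rw [abs_lt]
  constructor <;> linarith

/-- **(iii) on the inner window, two-sided with the SAME `c′` and a non-strict lower side, from the
banked nodes AS PRINTED**: `α − c′α²𝓛 ≤ γ′ − γ < α + c′α²𝓛` for consecutive zeros of `Ω` whose lower
zero satisfies `|γ − 2πt₀| < 𝓛₁ + 3/2` (the form "(iii) with `≤` on the lower side" of seam (s3)).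
[cite: Zhang2022LandauSiegel, §4 p. 23, tex L1263–L1264] -/
theorem prop22iii_inner_le_of_printed (c' : ℝ) (h42 : Lemma42) (hI : Prop22i) (h46 : Lemma46 c')
    (h47 : Lemma47 c') :
    ForAllLarge fun D _ χ => ∀ x ∈ PsiOne χ, ∀ s ∈ prodZeroSetOmega χ x,
      ∀ s' ∈ prodZeroSetOmega χ x, |s.im - 2 * π * t0 D| < ell1 D + 3 / 2 → s.im < s'.im →
        (∀ s'' ∈ prodZeroSetOmega χ x, ¬ (s.im < s''.im ∧ s''.im < s'.im)) →
          alpha D - c' * alpha D ^ 2 * ell D ≤ s'.im - s.im ∧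
            s'.im - s.im < alpha D + c' * alpha D ^ 2 * ell D := by
  obtain ⟨C₂, h2⟩ := h42
  obtain ⟨D₀, hall⟩ := ((h2.and hI).and h46).and h47
  refine ⟨max D₀ ⌈Real.exp (3 * Real.pi * |c'| + 4 + 2 * max C₂ 1)⌉₊,
    fun D _ χ hD hq hp x hx s hs s' hs' hsin hlt hcons => ?_⟩
  obtain ⟨⟨⟨h42D, hID⟩, h46D⟩, h47D⟩ := hall D χ (le_trans (le_max_left _ _) hD) hq hp
  obtain ⟨hD3, hα, hℓ0, hRR, hR_half, hR_log, hlogpos, h227⟩ :=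
    edge_thresholds (c' := c') (C₂ := C₂) (le_trans (le_max_right _ _) hD)
  have hF0 : ∀ z ∈ Omega1 D, Fpoly χ x z ≠ 0 := by
    intro z hz hF
    have h := h42D x hx z hz
    rw [hF, zero_mul, zero_sub, norm_neg, norm_one] at h
    linarith
  have hline : ∀ z : ℂ, 0 < z.re → z.re < 1 → |z.im - 2 * π * t0 D| < ell1 D + 2 →
      LL χ x z = 0 → z.re = 1 / 2 := by
    intro z h0 h1 hw hz
    refine hID x hx z ⟨(mem_Omega_iff' z).mpr ⟨?_, hw⟩, hz⟩
    rw [abs_lt]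
    constructor <;> linarith
  have hsre : s.re = 1 / 2 := hID x hx s hs
  have hs're : s'.re = 1 / 2 := hID x hx s' hs'
  obtain ⟨hsΩ, hsz⟩ := hs
  obtain ⟨hs'Ω, hs'z⟩ := hs'
  obtain ⟨-, hsim⟩ := (mem_Omega_iff' s).mp hsΩ
  obtain ⟨-, hs'im⟩ := (mem_Omega_iff' s').mp hs'Ω
  obtain ⟨hi1, hi2⟩ := abs_lt.mp hsim
  have hz : LL χ x s = 0 := hsz
  have hz' : LL χ x s' = 0 := hs'z
  have hA : calA χ x s = 0 := by
    simp only [calA, hz, zero_div]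
  have hT3 := h47D x hx s hA hsre hsim
  obtain ⟨-, -, hdisc⟩ := h46D x hx s hA hsre.symm.le (by rw [hsre]; nlinarith) hsim
  have hW₀ : (3 / 2 : ℝ) ≤ 2 := by norm_num
  have hW : (3 / 2 : ℝ) + 1 / 2 ≤ 2 := by norm_num
  have hdlt : s'.im - s.im < alpha D * (1 + c' * alpha D * ell D) :=
    gap_lt_of_three_zeros_win hα hRR hR_half hR_log hF0 hline
      (fun ρ hAρ h1 h2 hw => (h46D x hx ρ hAρ h1 h2 hw).2.2) hT3 hsre hW₀ hW hsin hz hs'im hcons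
  have hdge : alpha D * (1 - c' * alpha D * ell D) ≤ s'.im - s.im :=
    gap_ge_of_open_punctured_disc_win hR_half hR_log hF0 hline hdisc hsre hW₀ hW hsin hs're hz'
      hlt hdlt
  have e1 : alpha D * (1 + c' * alpha D * ell D) = alpha D + c' * alpha D ^ 2 * ell D := by ring
  have e2 : alpha D * (1 - c' * alpha D * ell D) = alpha D - c' * alpha D ^ 2 * ell D := by ring
  constructor <;> linarith

end Literature.NumberTheory.LFunctions.Zhang2022.Skeleton
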